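import Summits.BirchSwinnertonDyer.BirchSwinnertonDyer.Theses.TwoAdicConverse
import Summits.BirchSwinnertonDyer.BirchSwinnertonDyer.Theorems.TwoAdicConverseLambdaHalfDefs
import Summits.BirchSwinnertonDyer.BirchSwinnertonDyer.Theorems.ByReductionTypeAtTwoGVISeed
import Literature.NumberTheory.EllipticCurves.KatoDivisibilityAllPrimes
import Literature.NumberTheory.EllipticCurves.PAdicLFunctionNeZeroHoldsProofs
import Literature.NumberTheory.EllipticCurves.PAdicLFunctionIntegralityAtTwoAutoProofs
import Literature.NumberTheory.EllipticCurves.IwasawaSelmerDualProofs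
import Literature.NumberTheory.EllipticCurves.CyclotomicIwasawaMainTheoremIrreducibleBaseChangeProofs
import Literature.NumberTheory.EllipticCurves.GaloisAction
import Literature.NumberTheory.EllipticCurves.TwoVariableSelmerDual
import Literature.NumberTheory.EllipticCurves.YanZhu2026.TwoVariableMainTheorems
import Literature.NumberTheory.EllipticCurves.YanZhu2026.GreenbergMainTheorems
import Literature.NumberTheory.EllipticCurves.YanZhu2026.PerrinRiouCyclotomicRestriction
import Literature.NumberTheory.EllipticCurves.BurungaleSkinnerTianWan2024.GreenbergMainStatementOPEN
import Literature.NumberTheory.EllipticCurves.YanZhu2026.GreenbergLFunctionCoordFree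
import Literature.NumberTheory.EllipticCurves.HeegnerPointsImaginaryQuadraticProofs
import Literature.Uncategorized.OrdPublishedInputsAtTwo
import HarnessLib

/-!
# Line `xi-dominant-klingen-two` — skeleton for crux `OrdLambdaHalfAtTwo` (item stmt-BirchSwinnertonDyer-19556)

Crux (route `TwoAdicConverse`; also wanted by `ByReductionTypeAtTwo` K4):
`Summit.BirchSwinnertonDyer.BirchSwinnertonDyer.Theses.TwoAdicConverse.OrdLambdaHalfAtTwo` — for every non-CM
globally minimal `W/ℚ`, good ordinary at `2`: `λ(L₀) ≤ λ(X(E/ℚ_∞))` for an integral lift `L₀ ≠ 0` of `c·L₂(f, α)`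
(the `λ`-half of the `2`-adic cyclotomic main conjecture in the EISENSTEIN direction; Kato gives `λ(X) ≤ λ(L₀)`).

## Idea (card `Ideas/xi-dominant-klingen-two.md`; triage `TRIAGE-r3-1.md` PASS-WITH-PRICE P1–P4; pen `PEN-PICK-19556-r1`
## ADD-8/11/12)

HABITAT: `ρ̄_{E,2} : G_ℚ → GL₂(𝔽₂) ≅ S₃` SURJECTIVE (`W.HasSurjectiveModNGaloisRep 2`).  The complement (rational
`2`-torsion = habitat (β) of `Lines/kato_determinant_greenberg_two.lean`; cyclic cubic image = habitat of
`Lines/birth.lean` / `Lines/elliptic_shadow_two.lean`) is the RESIDUAL stub `stub_nonSurjectiveResidual`.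
On the habitat the Eisenstein lower bound for Selmer is produced NOT on `GL₂/ℚ` and NOT on `U(2,2)` (the
`f`-dominant placements — Skinner–Urban, Mazur–Wiles, CGLS, Yan–Zhu Cor. 4.6 — need (irr)+(dist) MOD 2, which is
unsatisfiable: both characters of a reducible `ρ̄ mod 2` are trivial, `XiDominantKlingenTwoSketch.modTwo_character_eq`),
but on `GU(3,1)/K` in the `ξ`-DOMINANT range (Wan 2020 ANT 14; Castella–Wan; BSTW 2024 §9.4): the auxiliary CM
character `ξ` of large infinity type carries the distinguishedness, `E` enters only through (irr_K) =
«`ρ̄_{E,2}|_{G_K}` absolutely irreducible», which the surjective habitat supplies for every imaginary quadratic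
`K ≠ ℚ(√Δ_E)`.  The output is the GREENBERG two-variable divisibility over `Λ_K^{ur}` AWAY FROM the primes pulled
back from `Λ^{cyc}` (BSTW Thm. 9.24 shape, `thm924_greenberg_dvd_charIdealXGr₂_awayFromCyc_OPEN` with `p = 2`);
then: remove the `Λ^{cyc}`-primes (P1, anticyclotomic `μ₂ = 0`), convert Greenberg ⟶ ordinary with the two-variable
Beilinson–Flach zeta element at `2` (BF2 = Yan–Zhu Thm. 4.7 / BSTW Prop. 1.19–Thm. 9.18 at `2`, `⊗ℚ`), descend to the
cyclotomic line (D = Yan–Zhu Cor. 2.9 + Lemma 5.3 + Prop. 3.7 at `2`, `⊗ℚ`) to the JOINT inequality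
`λ(L₂(E)) + λ(L₂(E^K)) ≤ λ(X(E)) + λ(X(E^K))`, and peel off the twist with Kato's `λ`-inequality for `E^K` (tree
theorem `GVISeed.isTorsion_and_lambda_le_lam_of_kato`, image-free at `2`, fed by the route's PUBLISHED-INPUTS item
19167 `stub_pub`).  `ω`-spine: `a + a' ≤ b + b'`, `b' ≤ a'` ⊢ `a ≤ b` (`omega`).

## THE 2-ADIC PAIR PHENOMENON (why the datum carries TWO generator pairs; see NOTES `Design v2`)

For `K = ℚ(√−q)`, `q ≡ 7 (mod 8)` prime (`2` split, `h_K` odd) one has `Γ_K = Gal(K̃/K) ≅ ℤ₂[Gal(K/ℚ)]` (the regular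
lattice): the cyclotomic and anticyclotomic `ℤ₂`-extensions share their first layer `K(√2)`, so `(κ_cyc, κ_ac)` is NOT
a `ℤ₂`-basis of `Hom(Γ_K, ℤ₂)` (index `2`) and **no pair `(γ₁, γ₂)` with `IsTopGeneratorPair κ_cyc κ_ac γ₁ γ₂` exists** —
every printed binder «`κ₁` cyclotomic ∧ `κ₂` anticyclotomic ∧ adapted pair» is vacuous at `p = 2`.  Two honest pairs:
* `pair  = (κ₁ = κ_cyc, κ₂ = a complement; γ₁, γ₂ dual)`: the CYCLOTOMIC line is the axis `T₂ = 0` — the currency of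
  `XOrd₂`, `IwasawaAlgebra₂.toPlus`, `cycRestrict`, Lemma 5.3 / Prop. 3.7 (stubs BF2-output, D);
* `pair′ = (κ₁′ = a complement, κ₂′ = κ_ac; γ₁′, γ₂′ dual)`: `γ₁′` generates `Γ_K^{c=+1} = ker κ_ac`, so the
  Klingen–Eisenstein exceptional primes («pulled back from `Λ^{cyc} = W⟦Γ_K^{c=+1}⟧`», BSTW «`⊗_{Λ^cyc} Frac Λ^cyc`»)
  are the functions of `T₁′` alone (`PowerSeries.map C s`, exactly the tree's shape) and the ANTICYCLOTOMIC line is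
  the axis `T₁′ = 0` (`UnrSeries₂.minus`) — the currency of `XGr₂`, the Katz / Greenberg frames, W2 and P1.
No pair has both axes (`ℤ₂(1+c) ⊕ ℤ₂(c−1)` has index `2` in `ℤ₂[C₂]`); in cyclotomic coordinates a `c`-vertical prime
is `Q((1+T₁)²(1+T₂) − 1)`, transverse to both axes and invisible to `μ` on either.  The change of pair is a ring
automorphism of `W⟦Γ_K⟧`; it is carried by BF2, whose zeta element lives intrinsically over `Λ_K`.

## Stubs (7; sorries ONLY here) and the prices paid
* `stub_pub` — P2: the Kato/modularity antecedent is the route's item 19167 BY NAME (no new content).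
* `stub_nonSurjectiveResidual` — P3: off-habitat residual (= `Birth.stub_nonsurj` verbatim; covered by the other lines).
* `stub_supplyAtTwo` — P3: the habitat datum `XiDatum` exists (K, both pairs, embeddings, (irr_K) from surjectivity, a
  non-split prime of `N`, twist ordinary at `2`).  ADDITIVE primes of `N` are NOT excluded (no `Squarefree N`): BSTW's
  square-free hypothesis is a local-automorphic convenience booked inside W2 (pen ADD-11: no separate residual).
* `stub_xiDominantGreenbergDivisibilityAtTwo` — W2, HARDEST: `2`-adic Hida/Klingen–Eisenstein family on `GU(3,1)`,
  staggered-conductor genericity (Wan's «all conductors `p^t`» genericity is EMPTY at `2`: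
  `XiDominantKlingenTwoSketch.div_eq_one_of_ne_one_of_two_elements`), `2`-adic Katz/Greenberg frames (∃), typed in
  P4's two-variable currency over pair′ with the `Λ^{cyc}`-witness VISIBLE (`s ∈ W⟦T₁′⟧ ∖ 0`).
* `stub_anticycMuZeroAtTwo` — P1 (pen ADD-12 name): `Λ^{cyc}`-localised ⟹ `2`-power-localised, for every ideal; the
  intended proof is `μ(𝓛^Gr₂|_{anticyc}) = 0 ∧ 𝓛^Gr₂|_{anticyc} ≠ 0` (Hsieh/Burungale-type at `2`, OPEN) + Weierstrass/UFD
  cancellation in `W⟦T₁′,T₂′⟧` + purity of `W⟦⟧ → 𝒪_{ℂ₂}⟦⟧`.  The line is `μ`-free on the CYCLOTOMIC side only.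
* `stub_zetaConversionAtTwo` — BF2 (P4): two-variable Beilinson–Flach classes at `2`, (nv), the explicit reciprocity
  laws LLZ/KLZ at `2`, Poitou–Tate over `Λ_K`, change of pair; `⊗ℚ` (no integral comparison claimed at `2`).
* `stub_cycDescentAtTwo` — D (P4): Cor. 2.9 (torsion from Kato×2), Lemma 5.3 (specialisation `T₂ = 0` + Shapiro
  `E × E^K`, `⊗ℚ`: the `E[2]`-splitting of Lemma 2.4 fails integrally at `2`), Prop. 3.7 (Hida = MTT×MTT at `2`).

## Disproof.lean honoured
No `_false_without_` theorem exists for this crux.  F0 (interface-honest: `D` pinned, honest `padicLFunction`, honest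
`lam`) — the composition produces the crux's own `∃ c L₀` with `c = 1` and Rohrlich's `L₀ ≠ 0`
(`padicLFunction_unitRoot_ne_zero`).  F1 (`OrdLambdaHalfAtTwoWithoutNewform` is false at `f = 0`): the line USES
`IsNewformOf W f` — `f = π.f` by `IsNewformOf.unique`, and every analytic stub is over `π.f`.  F5 («a two-variable
`Λ_K`-adic 2-adic `L` for non-CM `f`, `2` split, remains unlocated»): booked as the `∃`-frame clause of W2, not assumed.
Dead lines of the crux (dihedral-rigidity v1/v2, mod-four-redei K2/K3, two-power-slack (Negative
`UnitKuriharaWitnessLevelOne`, p651356), omega-adic-kolyvagin) share no stub with this line: no Kurihara/Kolyvagin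
number, no Rédei matrix, no level-one parity statement occurs below.
-/

set_option linter.dupNamespace false
set_option autoImplicit false

noncomputable section

open scoped MatrixGroups ModularForm
open PowerSeries CongruenceSubgroup WeierstrassCurve NumberField IsDedekindDomain Field
open Literature.NumberTheory.EllipticCurves Literature.NumberTheory.EllipticCurves.ModularForms
open Literature.NumberTheory.EllipticCurves.Rank1Residual
open Literature.NumberTheory.GaloisRepresentations
open Literature.NumberTheory.EllipticCurves.IwasawaAlgebra₂
open Summit.BirchSwinnertonDyer.BirchSwinnertonDyer.Theorems.TwoAdicTwistConverse (LambdaHalfAtTwo)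
open Summit.BirchSwinnertonDyer.Rank1Residual.X1.MuLambda (lam)

namespace Summit.BirchSwinnertonDyer.BirchSwinnertonDyer.Cruxes.OrdLambdaHalfAtTwo.XiDominantKlingenTwo

/-! ## §1 The habitat datum (posited interface; its existence is `stub_supplyAtTwo`) -/

/-- **The `ξ`-dominant datum of `W` at `2`** relative to the crux's cyclotomic normalisation `(κ, γ)` of `ℚ`:
an imaginary quadratic `K` with `2 = v v̄` split, `(N_E, d_K) = 1`, `ρ̄_{E,2}|_{G_K}` absolutely irreducible, a prime of
`N_E` NOT split in `K` (BSTW (spl)), embedding data `ι : ℚ̄₂ ≃ ℂ` (inducing `v`), `ι₁`, a structure map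
`J : ℤ₂ → 𝒪_{ℂ₂}`, and the TWO generator pairs of the 2-adic pair phenomenon (module docstring): `pair = (κ₁ = κ_cyc,
κ₂; γ₁, γ₂)` restricting to `(κ, γ)` on `ℚ`, and `pair′ = (κ₁′, κ₂′ = κ_ac; γ₁′, γ₂′)`.  `= GreenbergSetting` of
Yan–Zhu minus `three_le` / `anticyclotomic` / `discr_odd` / `discr_ne` (BDP-only fields), plus the habitat fields.
A Type-valued interface: NO existence is smuggled (that is `stub_supplyAtTwo`). -/
structure XiDatum (W : WeierstrassCurve ℚ) [W.IsElliptic] [W.IsGloballyMinimal]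
    (κ : ZpExtension ℚ 2) (γ : absoluteGaloisGroup ℚ) : Type 1 where
  /-- The imaginary quadratic field. -/
  K : Type
  [field : Field K]
  [numberField : NumberField K]
  [discrNeZero : NeZero (NumberField.discr K).natAbs]
  /-- Embedding datum `ℚ̄₂ ≃ ℂ`. -/
  ι : PadicAlgCl 2 ≃+* ℂ
  /-- `ι₁ : ℤ̄ → ℂ₂` compatible with `ι`. -/
  ι₁ : integralClosure ℚ ℂ →+* ℂ_[2]
  ι₁_compat : ∀ z : integralClosure ℚ ℂ, ι₁ z = ((ι.symm (z : ℂ) : PadicAlgCl 2) : ℂ_[2])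
  /-- Structure map `ℤ₂ → 𝒪_{ℂ₂}` (reading `Λ_K ⊂ Λ_K^{ur} ⊂ 𝒪_{ℂ₂}⟦T₁,T₂⟧`). -/
  J : ℤ_[2] →+* PadicComplexInt 2
  J_compat : ∀ x : ℤ_[2], ((J x : PadicComplexInt 2) : ℂ_[2]) = ((x : ℚ_[2]) : ℂ_[2])
  /-- The two primes above `2`. -/
  v : HeightOneSpectrum (𝓞 K)
  vbar : HeightOneSpectrum (𝓞 K)
  /-- pair: cyclotomic-adapted. -/
  κ₁ : ZpExtension K 2
  κ₂ : ZpExtension K 2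
  γ₁ : absoluteGaloisGroup K
  γ₂ : absoluteGaloisGroup K
  [pair : Fact (ZpExtension.IsTopGeneratorPair κ₁ κ₂ γ₁ γ₂)]
  /-- pair′: anticyclotomic-adapted. -/
  κ₁' : ZpExtension K 2
  κ₂' : ZpExtension K 2
  γ₁' : absoluteGaloisGroup K
  γ₂' : absoluteGaloisGroup K
  [pair' : Fact (ZpExtension.IsTopGeneratorPair κ₁' κ₂' γ₁' γ₂')]
  isImaginaryQuadratic : IsImaginaryQuadratic K
  split : ((Ideal.span {(2 : ℤ)}).primesOver (𝓞 K)).ncard = 2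
  mem_v : ((2 : ℕ) : 𝓞 K) ∈ v.asIdeal
  mem_vbar : ((2 : ℕ) : 𝓞 K) ∈ vbar.asIdeal
  vbar_ne : vbar ≠ v
  compat : ∀ (w : InfinitePlace K) (k : 𝓞 K), k ∈ v.asIdeal ↔ ‖ι.symm (w.embedding (k : K))‖ < 1
  coprime : IsCoprime (W.conductorNorm ℤ : ℤ) (NumberField.discr K)
  /-- (irr_K): `ρ̄_{E,2}|_{G_K}` absolutely irreducible (from surjectivity and `K ≠ ℚ(√Δ_E)`). -/
  absIrr : ∀ ρ : ModPGaloisRep K (ZMod 2) 2, (W.baseChange K).IsTorsionGaloisRep 2 ρ →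
    FramedRep.IsAbsolutelyIrreducible ρ
  /-- (spl): some prime of the conductor does not split in `K`. -/
  exists_nonsplit : ∃ q : ℕ, q.Prime ∧ (q : ℤ) ∣ W.conductorNorm ℤ ∧
    ((Ideal.span {(q : ℤ)}).primesOver (𝓞 K)).ncard ≠ 2
  cyclotomic : κ₁.IsCyclotomic
  anticyclotomic : κ₂'.IsAnticyclotomic
  /-- `γ₁` restricts to the crux's generator `γ` of `Gal(ℚ_∞/ℚ)` (same normalisation). -/
  restrict_topGenerator : κ.IsTopGenerator (absGaloisRestrict ℚ K γ₁)
  restrict_cyclotomicVariable : IsCyclotomicVariable 2 (absGaloisRestrict ℚ K γ₁)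
  /-- Every minimal model of the twist `E^K = E^{(d_K)}` is good ordinary at `2` (`2` split in `K`). -/
  twist_ordinary : ∀ (A : WeierstrassCurve ℚ) [A.IsElliptic] [A.IsGloballyMinimal] (C : VariableChange ℚ),
    C • A = W.quadraticTwist ((NumberField.discr K : ℤ) : ℚ) → IsOrdinaryAt A 2

attribute [instance] XiDatum.field XiDatum.numberField XiDatum.discrNeZero XiDatum.pair XiDatum.pair'

variable {W : WeierstrassCurve ℚ} [W.IsElliptic] [W.IsGloballyMinimal] {κ : ZpExtension ℚ 2}
  {γ : absoluteGaloisGroup ℚ}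

/-- **A Katz / Greenberg frame pair at `2` over pair′** (the tree's reduction-type-free frames, `p = 2`), WITH
its period data: `LK` IS `𝓛_v(K)` (`IsKatzMeasure₂`, periods `Ω ≠ 0`, `δ² = ±d_K`, `Ω₂ ∈ W^×`) and `G` IS
`𝓛_2^Gr(f/K)` (`IsGreenbergLFunctionAnyRoot₂`), both in the variables `(T₁′, T₂′) = (γ₁′ − 1, γ₂′ − 1)`.
A Type-valued record of tree predicates (no existence smuggled: frames are produced by W2). -/
structure XiDatum.GreenbergFrame (X : XiDatum W κ γ) {N : ℕ} (f : CuspForm (Gamma0 N) 2)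
    (LK G : PowerSeries (PowerSeries (PadicComplexInt 2))) : Type where
  /-- complex period. -/
  Ω : ℂ
  /-- `δ = √(±d_K)`. -/
  δ : ℂ
  /-- `2`-adic period, a unit of `W`. -/
  Ωp : (unrIntegers 2)ˣ
  Ω_ne : Ω ≠ 0
  δ_sq : δ ^ 2 = (NumberField.discr X.K : ℂ) ∨ δ ^ 2 = -(NumberField.discr X.K : ℂ)
  katz : IsKatzMeasure₂ X.ι X.v X.vbar ∅ X.κ₁' X.κ₂' X.γ₁'⁻¹ X.γ₂'⁻¹ 1 Ω δ ((Ωp : unrIntegers 2) : ℂ_[2]) LK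
  greenberg :
    haveI : IsCMField X.K := Literature.NumberTheory.EllipticCurves.IsImaginaryQuadratic.isCMField
      X.isImaginaryQuadratic
    Literature.NumberTheory.EllipticCurves.YanZhu2026.IsGreenbergLFunctionFree₂ X.ι X.v X.vbar X.κ₁' X.κ₂'
      X.γ₁'⁻¹ X.γ₂'⁻¹ f
    (NumberField.discr X.K).natAbs (NumberField.classNumber X.K) LK G

/-! ## §2 The stubs -/

/-- **stub 1 (P2; CITE-LEVEL = the route's own PUBLISHED-INPUTS item 19167, BY NAME).**
`Literature.Uncategorized.OrdConversePublishedInputsAtTwo` = modularity (`nonempty_modularParametrizationData`,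
Wiles / BCDT) ∧ Kato 2004 Thm. 17.4 (1)(2) AT `2` for every globally minimal curve and its newform
(`kato_divisibility_allPrimes W 2`, image-free; used here for `W` AND for the twist `E^K` inside D, and for the
twist's `λ`-inequality at the door) ∧ Greenberg 1999 Thm. 4.1 (unused).  Not new content: a registered obligation
of route `TwoAdicConverse` (item stmt-BirchSwinnertonDyer-19167). -/
theorem stub_pub : Literature.Uncategorized.OrdConversePublishedInputsAtTwo := by
  sorry

/-- **stub 2 (P3; off-habitat RESIDUAL, = `Lines/birth.lean` `stub_nonsurj` verbatim).**  If `ρ̄_{E,2}` is NOT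
surjective (a rational `2`-torsion point — habitat (β) of `kato_determinant_greenberg_two` — or cyclic cubic image —
habitat of `birth` / `elliptic_shadow_two`), the crux instance `LambdaHalfAtTwo W` holds.  Why it might fail: it is
the crux on the complement habitat; it is exactly what the other registered lines must deliver (no new claim here).
[source: Lines/birth.lean, Lines/kato_determinant_greenberg_two.lean, Lines/elliptic_shadow_two.lean] -/
theorem stub_nonSurjectiveResidual :
    ∀ (W : WeierstrassCurve ℚ) [W.IsElliptic] [W.IsGloballyMinimal],
      ¬ W.HasCM → GoodOrd W 2 → ¬ W.HasSurjectiveModNGaloisRep 2 → LambdaHalfAtTwo W := by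
  sorry

/-- **stub 3 (P3; SUPPLY, M).**  On the surjective habitat the datum exists: choose a prime `q₀ ≡ 7 (mod 8)` with
`q₀ ∤ N_E`, `ℚ(√−q₀) ≠ ℚ(√Δ_E)` and `χ_{−q₀}(ℓ) = −1` for some `ℓ ∣ N_E` (Dirichlet/CRT; infinitely many), `K = ℚ(√−q₀)`:
`2` splits (`−q₀ ≡ 1 mod 8`), `h_K` odd, `(N_E, d_K) = 1`; `ρ̄_{E,2}(G_K) = S₃` still (the unique index-`2` subgroup of
`S₃` is cut out by `ℚ(√Δ_E) ≠ K`) and `S₃ ⊂ GL₂(𝔽̄₂)` is absolutely irreducible (irr_K); (spl) by the choice of `ℓ`;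
`ι`, `ι₁`, `J` exist (`ℂ ≃ ℚ̄₂` abstractly; `ℤ₂ → 𝒪_{ℂ₂}`); the pairs: `Hom(Γ_K, ℤ₂) = ℤ₂κ_cyc ⊕ ℤ₂κ₂ = ℤ₂κ₁′ ⊕ ℤ₂κ_ac`
for suitable complements (both `κ_cyc`, `κ_ac` are primitive), dual bases `(γ₁, γ₂)`, `(γ₁′, γ₂′)` lifted to `G_K`,
with `γ₁ ↦ γ` under `G_K → G_ℚ → Gal(ℚ_∞/ℚ)` (`κ_cyc = κ ∘ res`, so `κ(res γ₁) = κ_cyc(γ₁) = 1`; adjust `γ₁` inside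
`γ₁ · ker` to hit the crux's `γ`-normalisation `IsCyclotomicVariable`); twist: `2 ∤ d_K`, `χ_K(2) = +1`, so a minimal
model of `E^{(d_K)}` has good reduction at `2` with `a₂(E^K) = a₂(E)` odd.  Why it might fail: only Lean plumbing
(Chebotarev-free: Dirichlet + CRT suffice); the `IsCyclotomicVariable` normalisation of `res γ₁` vs. the given `γ` is
the one delicate point (the crux fixes `γ`; we need `γ₁` over it — `res` is surjective onto `Gal(ℚ_∞/ℚ)` since
`K ∩ ℚ_∞ = ℚ`).  [source: BSTW2024 §9.4 (spl)/(irr_L); Serre1972 §5.3 (image `S₃`); tree `exists_greenbergPair`-type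
supply of `CyclotomicIwasawaMainTheoremIrreducibleBaseChangeProofs`] -/
theorem stub_supplyAtTwo :
    ∀ (W : WeierstrassCurve ℚ) [W.IsElliptic] [W.IsGloballyMinimal],
      ¬ W.HasCM → GoodOrd W 2 → W.HasSurjectiveModNGaloisRep 2 →
    ∀ (κ : ZpExtension ℚ 2) (γ : absoluteGaloisGroup ℚ),
      κ.IsCyclotomic → κ.IsTopGenerator γ → IsCyclotomicVariable 2 γ →
    Nonempty (XiDatum W κ γ) := by
  sorry

/-- **stub 4 = W2 (HARDEST; XL, research).  `ξ`-dominant Klingen–Eisenstein divisibility on `GU(3,1)` at `p = 2`,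
Greenberg side, AWAY FROM `Λ^{cyc}`** — the `p = 2` case of BSTW Thm. 9.24 (`thm924_…_awayFromCyc_OPEN`, there typed
with `p ≠ 2`) / Wan 2020 Thm. 1.1 / Castella–Wan, in pair′-coordinates: there EXIST a Katz frame `LK` and a
`W`-rational Greenberg frame `G = 𝓛_2^Gr(f/K)` (F5 of `Disproof.lean`: unlocated in print at `2` — part of the claim),
and a non-zero `c`-VERTICAL witness `s ∈ W⟦T₁′⟧` with `s · ξ(X_Gr)^{ur} ⊆ (G)`.  Ingredients at `2` (all OPEN, booked
here, pen ADD-11 «no separate residuals»): (i) `2`-adic Hida theory for `GU(3,1)/K` and the Klingen–Eisenstein family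
with `ξ`-dominant weight; (ii) Wan's genericity re-typed with STAGGERED conductors (`cond ξᵢ = 2^t`, `cond χ = 2^s`,
`s < t`) — the verbatim «all conductors exactly `p^t`, characters pairwise distinct» is EMPTY at `2`; (iii) the
Fourier–Jacobi non-vanishing modulo `2`; (iv) ADDITIVE primes of `N_E` handled inside the local doubling integrals
(BSTW assume `N` square-free for convenience; no `Squarefree` hypothesis here); (v) (irr_K) replaces (irr)+(dist);
(vi) through the tree's junk convention `char(non-torsion) = ⊤` the claim includes «`X_Gr(E/K_∞)` is
`Λ_K`-torsion at `2`» (Yan–Zhu Cor. 2.10 / CGS at `2`; Kato at `2` for `E`, `E^K` supplied as hypotheses).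
Why it might fail: `2`-adic Hida theory on unitary groups of signature `(3,1)` with the needed control/freeness is
unwritten; the mod-`2` theta-lift non-vanishing (Fourier–Jacobi step) may genuinely fail at `2`; the `Λ^{cyc}`-witness
might be forced into `W⟦Γ^{c=+1}⟧` only up to the index-`2` sublattice issues of the pair phenomenon.
[source: Wan2020ANT Thm 1.1; arXiv:2409.01350v2 (BSTW) Thm 9.24, §9.4; CastellaWan (Perrin-Riou Heegner main
conjecture) §3; tree `thm924_greenberg_dvd_charIdealXGr₂_awayFromCyc_OPEN`] -/
theorem stub_xiDominantGreenbergDivisibilityAtTwo :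
    ∀ (W : WeierstrassCurve ℚ) [W.IsElliptic] [W.IsGloballyMinimal],
      ¬ W.HasCM → GoodOrd W 2 → W.HasSurjectiveModNGaloisRep 2 →
    ∀ (κ : ZpExtension ℚ 2) (γ : absoluteGaloisGroup ℚ),
      κ.IsCyclotomic → κ.IsTopGenerator γ → IsCyclotomicVariable 2 γ →
    ∀ [NeZero (W.conductorNorm ℤ)] (π : ModularParametrizationData W (W.conductorNorm ℤ))
      (X : XiDatum W κ γ), kato_divisibility_allPrimes W 2 (f := π.f) →
    ∀ (A : WeierstrassCurve ℚ) [A.IsElliptic] [A.IsGloballyMinimal] (C : VariableChange ℚ),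
      C • A = W.quadraticTwist ((NumberField.discr X.K : ℤ) : ℚ) →
    ∀ [NeZero (A.conductorNorm ℤ)] (g : CuspForm (Gamma0 (A.conductorNorm ℤ)) 2), IsNewformOf A g →
      kato_divisibility_allPrimes A 2 (f := g) →
    ∃ (LK G : PowerSeries (PowerSeries (PadicComplexInt 2))) (_ : X.GreenbergFrame π.f LK G),
      (∀ i j : ℕ, ((PowerSeries.coeff j (PowerSeries.coeff i G) : PadicComplexInt 2) : ℂ_[2]) ∈ unrIntegers 2) ∧
      ∃ s : PowerSeries (PadicComplexInt 2), s ≠ 0 ∧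
        (∀ i : ℕ, ((PowerSeries.coeff i s : PadicComplexInt 2) : ℂ_[2]) ∈ unrIntegers 2) ∧
        Ideal.span {PowerSeries.map (PowerSeries.C (R := PadicComplexInt 2)) s} *
            (WeierstrassCurve.XGr₂.charIdeal (W.baseChange X.K) 2 X.κ₁' X.κ₂' X.vbar X.γ₁' X.γ₂').map
              (toUnr₂ 2 X.J) ≤
          Ideal.span {G} := by
  sorry

/-- **stub 5 = P1 `stub_anticycMuZeroAtTwo` (L, research; the triage's «no `Λ^{cyc}`-divisor» input, pen ADD-12).**
For a `W`-rational Greenberg frame `G` at `2` (pair′-coordinates): whatever ideal `I ⊆ Λ_K` is divisible by `G` after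
inverting a non-zero `c`-vertical `s ∈ W⟦T₁′⟧` is divisible by `G` after inverting `2` alone.  Intended proof (the
NAME): restrict to the anticyclotomic axis `T₁′ = 0` (`UnrSeries₂.minus G = G(0, T₂′)`): a distinguished vertical
prime `Q(T₁′) ∣ G` forces `Q(0) ∣ G(0,T₂′)` with `Q(0) ∈ 2W ∖ W^×`, i.e. `μ(G|_{ac}) ≥ 1` or `G|_{ac} = 0`; so
**`μ(𝓛_2^Gr(f/K)|_{ac}) = 0` and `𝓛_2^Gr|_{ac} ≠ 0`** (anticyclotomic `μ₂ = 0`: Hsieh 2014 / Burungale 2017 prove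
`μ(𝓛^BDP) = 0` for ODD `p`; Yan–Zhu Prop. 3.14 / BSTW Prop. 1.22 compare `𝓛^Gr|_{ac}` with `𝓛^BDP`; at `2`:
Kriz–Li FMS 2019 only for CM-point congruences — OPEN) kill every vertical factor of positive degree; then
`gcd(G, s) ∣ 2^∞` in the UFD `W⟦T₁′,T₂′⟧` and purity of `W⟦⟧ → 𝒪_{ℂ₂}⟦⟧` give `2^n · J(x) ∈ (G)`.
Why it might fail: anticyclotomic `μ = 0` at `p = 2` is unproved and the `2`-adic Gross/CM-period unit argument of
Hsieh (toric forms mod `p`, `p ∤ 6`) does not transpose verbatim; `G|_{ac}` could vanish identically if the Greenberg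
frame degenerates at `2`.  [source: Hsieh2014Documenta Thm B; Burungale2017 (μ of anticyclotomic RS); KrizLi2019FMS
Thm 7.1; arXiv:2412.20078v4 Prop 3.14; arXiv:2409.01350v2 Prop 1.22, Thm 1.24] -/
theorem stub_anticycMuZeroAtTwo :
    ∀ (W : WeierstrassCurve ℚ) [W.IsElliptic] [W.IsGloballyMinimal],
      ¬ W.HasCM → GoodOrd W 2 → W.HasSurjectiveModNGaloisRep 2 →
    ∀ (κ : ZpExtension ℚ 2) (γ : absoluteGaloisGroup ℚ),
      κ.IsCyclotomic → κ.IsTopGenerator γ → IsCyclotomicVariable 2 γ →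
    ∀ [NeZero (W.conductorNorm ℤ)] (π : ModularParametrizationData W (W.conductorNorm ℤ))
      (X : XiDatum W κ γ) (LK G : PowerSeries (PowerSeries (PadicComplexInt 2))) (_ : X.GreenbergFrame π.f LK G),
      (∀ i j : ℕ, ((PowerSeries.coeff j (PowerSeries.coeff i G) : PadicComplexInt 2) : ℂ_[2]) ∈ unrIntegers 2) →
    ∀ (I : Ideal (IwasawaAlgebra₂ 2)) (s : PowerSeries (PadicComplexInt 2)), s ≠ 0 →
      (∀ i : ℕ, ((PowerSeries.coeff i s : PadicComplexInt 2) : ℂ_[2]) ∈ unrIntegers 2) →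
      Ideal.span {PowerSeries.map (PowerSeries.C (R := PadicComplexInt 2)) s} * I.map (toUnr₂ 2 X.J) ≤
        Ideal.span {G} →
      ∃ n : ℕ, Ideal.span {toUnr₂ 2 X.J 2 ^ n} * I.map (toUnr₂ 2 X.J) ≤ Ideal.span {G} := by
  sorry

/-- **stub 6 = BF2 (XL, research; P4 «(nv) and the reciprocity chain at `2` named»).  Greenberg ⟶ ordinary
conversion by the two-variable Beilinson–Flach zeta element at `2`, `⊗ℚ`** — the `p = 2` analogue of Yan–Zhu
Thm. 4.7 (2) ⟹ (1) with `S = {2ⁿ}` (`thm47_ord_localised_iff_greenberg_localised`, printed for `p > 2`) = BSTW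
Prop. 1.19 / Thm. 9.18 / Cor. 9.23: if `2^n · ξ(X_Gr)^{ur} ⊆ (G)` for a Greenberg frame over pair′, then there is a
Hida–Rankin frame `F = 𝓛_2^I(f/K)` over pair (`IsHidaRankinLFunction`, `IsCongruenceIntegral`: Hida's `2`-adic Rankin–Selberg
measure, Yan–Zhu Thm. 3.3 at `2`) with `2^m · Char(X_ord(E/K_∞)) ⊆ (𝓛_2^PR(E/K))` (`IdealLeSpanAway 2`).  Chain at
`2`, each link NAMED: (a) two-variable BF classes `BF_{Λ_K}` for `f ⊗ (Λ_K`-adic CM family) at `p = 2` (LLZ 2014 and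
KLZ 2017 assume `p ≥ 5` resp. `p > 2`: OPEN); (b) (nv) `𝓛_v̄(BF) ≠ 0` (from the Greenberg frame `≠ 0` via (c));
(c) explicit reciprocity laws at `v̄` (`BF ↦ 𝓛^Gr`) and at `v` (`BF ↦ 𝓛^I`, Ohta/KLZ) at `2`; (d) Poitou–Tate over
`Λ_K` and `Λ_K`-torsionness `X_Gr ↔ X_ord` (Yan–Zhu Cor. 2.10 at `2`); (e) the change of pair pair′ ⟶ pair (a ring
automorphism of `W⟦Γ_K⟧` transporting `ξ(X_Gr)` and `(G)`; folklore, M in Lean).  Why it might fail: (a)–(c) at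
`p = 2` are unwritten and the `2`-adic Eichler–Shimura/Ohta integrality behind (c) has genuine `2`-torsion; only the
`⊗ℚ` statement is claimed, which is all D consumes.  [source: arXiv:2412.20078v4 Thm 4.7, Cor 2.10; arXiv:2409.01350v2
Prop 1.19, Thm 9.18, Cor 9.23; LeiLoefflerZerbes2014 Annals; KingsLoefflerZerbes2017; tree `thm47_…`,
`idealLeSpan_perrinRiou_of_thm47_of_thm42`] -/
theorem stub_zetaConversionAtTwo :
    ∀ (W : WeierstrassCurve ℚ) [W.IsElliptic] [W.IsGloballyMinimal],
      ¬ W.HasCM → GoodOrd W 2 → W.HasSurjectiveModNGaloisRep 2 →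
    ∀ (κ : ZpExtension ℚ 2) (γ : absoluteGaloisGroup ℚ),
      κ.IsCyclotomic → κ.IsTopGenerator γ → IsCyclotomicVariable 2 γ →
    ∀ [NeZero (W.conductorNorm ℤ)] (π : ModularParametrizationData W (W.conductorNorm ℤ))
      (X : XiDatum W κ γ) (LK G : PowerSeries (PowerSeries (PadicComplexInt 2))) (_ : X.GreenbergFrame π.f LK G),
      (∀ i j : ℕ, ((PowerSeries.coeff j (PowerSeries.coeff i G) : PadicComplexInt 2) : ℂ_[2]) ∈ unrIntegers 2) →
      kato_divisibility_allPrimes W 2 (f := π.f) →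
    ∀ (A : WeierstrassCurve ℚ) [A.IsElliptic] [A.IsGloballyMinimal] (C : VariableChange ℚ),
      C • A = W.quadraticTwist ((NumberField.discr X.K : ℤ) : ℚ) →
    ∀ [NeZero (A.conductorNorm ℤ)] (g : CuspForm (Gamma0 (A.conductorNorm ℤ)) 2), IsNewformOf A g →
      kato_divisibility_allPrimes A 2 (f := g) →
      (∃ n : ℕ, Ideal.span {toUnr₂ 2 X.J 2 ^ n} *
          (WeierstrassCurve.XGr₂.charIdeal (W.baseChange X.K) 2 X.κ₁' X.κ₂' X.vbar X.γ₁' X.γ₂').map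
            (toUnr₂ 2 X.J) ≤ Ideal.span {G}) →
    ∃ F : CycAntiSeries 2, IsHidaRankinLFunction X.ι₁ W X.κ₁ X.κ₂ π.f F ∧ IsCongruenceIntegral π.f F ∧
      IdealLeSpanAway (2 : IwasawaAlgebra₂ 2)
        (WeierstrassCurve.XOrd₂.charIdeal (W.baseChange X.K) 2 X.κ₁ X.κ₂ X.γ₁ X.γ₂)
        (perrinRiouLFunction W π F) := by
  sorry

/-- **stub 7 = D (L; P4 «`⊗ℚ` descent»).  Cyclotomic descent at `2`, rationally**: from the `2`-power-localised
ordinary two-variable divisibility `2^m · Char(X_ord(E/K_∞)) ⊆ (𝓛_2^PR)` (pair-coordinates, cyclotomic axis `T₂ = 0`)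
to the JOINT `λ`-inequality `λ(L₀) + λ(L₀′) ≤ λ(X(E/ℚ_∞)) + λ(X(E^K/ℚ_∞))` for integral lifts `L₀, L₀′ ≠ 0` of
`c·L₂(f_E, α)`, `c′·L₂(f_{E^K}, α′)`.  Three printed steps at `p = 2`: (i) Yan–Zhu Cor. 2.9 — `X_ord(E/K_∞)` is
`Λ_K`-torsion, from Kato's divisibility at `2` for `E` and `E^K` (hypotheses) + control; (ii) Lemma 5.3 —
`(Char X_ord) mod (γ₂ − 1) ⊆ Char(X(E/K^{cyc}_∞)) = Char(X(E/ℚ_∞)) · Char(X(E^K/ℚ_∞))` (Shapiro), valid `⊗ℚ` at `2`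
(the integral `E[2]`-splitting of Lemma 2.4 fails; `λ` survives, `μ` is not claimed — the line is `μ`-free on the
cyclotomic side); (iii) Prop. 3.7 — `𝓛_2^PR(E/K)|_{T₂=0} = u · L₂(E) · L₂(E^K)`, `u ∈ (Λ ⊗ ℚ)^×` (Hida's `2`-adic
Rankin–Selberg measure restricted to the cyclotomic line = product of the two Mazur–Tate–Teitelbaum measures; tree
shape `prop37_cycRestrict_perrinRiou_eq_padicLFunction_mul`, printed `p > 2`); then `λ` is additive and monotone under
divisibility up to `2`-powers (`MuLambda.lam_mul`, `lam_le_of_mul_eq_C_pow_mul` of the sketch).  Why it might fail: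
(iii) at `2` needs the `2`-adic interpolation formula of `𝓛^I` on the cyclotomic line with the SAME periods as MTT
(Perrin-Riou's constant `c_PR` has a `2`-adic unit ambiguity only `⊗ℚ` — harmless for `λ`); (i) needs the `2`-adic
control theorem for `X_ord` over the `ℤ₂²`-extension (Greenberg-style, `a₂` unit, fine) — no step is known to break,
none is written at `2`.  [source: arXiv:2412.20078v4 Cor 2.9, Lemma 5.3, Prop 3.7, Lemma 2.4; tree
`YanZhu2026.prod_charIdeal_le_span_of_facts` (the `p > 2` algebra mirrored here)] -/
theorem stub_cycDescentAtTwo :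
    ∀ (W : WeierstrassCurve ℚ) [W.IsElliptic] [W.IsGloballyMinimal],
      ¬ W.HasCM → GoodOrd W 2 → W.HasSurjectiveModNGaloisRep 2 →
    ∀ (κ : ZpExtension ℚ 2) (γ : absoluteGaloisGroup ℚ) (hκ : κ.IsCyclotomic) (hγ : κ.IsTopGenerator γ),
      IsCyclotomicVariable 2 γ → IsOrdinaryAt W 2 →
    ∀ [NeZero (W.conductorNorm ℤ)] (π : ModularParametrizationData W (W.conductorNorm ℤ))
      (X : XiDatum W κ γ) (F : CycAntiSeries 2),
      IsHidaRankinLFunction X.ι₁ W X.κ₁ X.κ₂ π.f F → IsCongruenceIntegral π.f F →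
      IdealLeSpanAway (2 : IwasawaAlgebra₂ 2)
        (WeierstrassCurve.XOrd₂.charIdeal (W.baseChange X.K) 2 X.κ₁ X.κ₂ X.γ₁ X.γ₂)
        (perrinRiouLFunction W π F) →
      kato_divisibility_allPrimes W 2 (f := π.f) →
    ∀ (A : WeierstrassCurve ℚ) [A.IsElliptic] [A.IsGloballyMinimal] (C : VariableChange ℚ),
      C • A = W.quadraticTwist ((NumberField.discr X.K : ℤ) : ℚ) → IsOrdinaryAt A 2 →
    ∀ [NeZero (A.conductorNorm ℤ)] (g : CuspForm (Gamma0 (A.conductorNorm ℤ)) 2), IsNewformOf A g →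
      kato_divisibility_allPrimes A 2 (f := g) →
    ∀ (D : W.SelmerDualData κ γ) (DA : A.SelmerDualData κ γ) (c c' : ℚ) (L₀ L₀' : IwasawaAlgebra 2),
      L₀ ≠ 0 → L₀' ≠ 0 →
      iwasawaToPowerSeries 2 L₀ = PowerSeries.C (c : ℚ_[2]) * padicLFunction π.f (unitRoot W 2 : ℚ_[2]) →
      iwasawaToPowerSeries 2 L₀' = PowerSeries.C (c' : ℚ_[2]) * padicLFunction g (unitRoot A 2 : ℚ_[2]) →
      lam L₀ + lam L₀' ≤ D.lambda + DA.lambda := by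
  sorry

/-! ## §3 Composition (kernel-checked; no `sorry` below this line) -/

/-- The integral lift of `L₂(f, α)` at `2` is non-zero (Rohrlich, `padicLFunction_unitRoot_ne_zero`) and is
`1 • L₂` in the crux's shape. -/
theorem lift_ne_zero_and_eq {W : WeierstrassCurve ℚ} [W.IsElliptic] [W.IsGloballyMinimal]
    {N : ℕ} [NeZero N] {f : CuspForm (Gamma0 N) 2} (hord : IsOrdinaryAt W 2) (hf : IsNewformOf W f)
    {L₀ : IwasawaAlgebra 2} (hL₀ : iwasawaToPowerSeries 2 L₀ = padicLFunction f (unitRoot W 2 : ℚ_[2])) :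
    L₀ ≠ 0 ∧ iwasawaToPowerSeries 2 L₀ =
      PowerSeries.C ((1 : ℚ) : ℚ_[2]) * padicLFunction f (unitRoot W 2 : ℚ_[2]) := by
  refine ⟨?_, ?_⟩
  · rintro rfl
    exact padicLFunction_unitRoot_ne_zero hord hf (by rw [← hL₀, map_zero])
  · rw [hL₀, Rat.cast_one, map_one, one_mul]

/-- **The skeleton theorem.**  The seven stubs imply the crux `OrdLambdaHalfAtTwo` (route decl, BY NAME):
habitat split; on the surjective habitat SUPPLY → W2 → P1 → BF2 → D → Kato for the twist → `omega`. -/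
theorem OrdLambdaHalfAtTwo_of :
    Summit.BirchSwinnertonDyer.BirchSwinnertonDyer.Theses.TwoAdicConverse.OrdLambdaHalfAtTwo := by
  intro W _ _ hCM hGO κ γ hκ hγ hγ' hord _ f hf D
  by_cases hs : W.HasSurjectiveModNGaloisRep 2
  swap
  · exact stub_nonSurjectiveResidual W hCM hGO hs κ γ hκ hγ hγ' hord f hf D
  obtain ⟨hMod, hKato, -⟩ := stub_pub
  -- `f` is THE newform of `W`: `f = π.f` for the modular parametrisation `π` (F1 of `Disproof.lean` honoured)
  obtain ⟨π⟩ := hMod W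
  obtain rfl : f = π.f := hf.unique π.isNewformOf
  -- the integral lift `L₀` of `L₂(f, α)` (Rohrlich: `≠ 0`)
  obtain ⟨L₀, hL₀⟩ := exists_iwasawaToPowerSeries_eq_padicLFunction_two_auto hord hf
  obtain ⟨hL₀0, hL₀1⟩ := lift_ne_zero_and_eq hord hf hL₀
  -- SUPPLY: the habitat datum
  obtain ⟨X⟩ := stub_supplyAtTwo W hCM hGO hs κ γ hκ hγ hγ'
  -- the twist `E^K`, its minimal model `A`, its newform `g`, Kato's `λ`-inequality for `A`
  have hd : ((NumberField.discr X.K : ℤ) : ℚ) ≠ 0 := by exact_mod_cast NumberField.discr_ne_zero X.K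
  obtain ⟨A, _, _, C, hA⟩ := exists_isGloballyMinimal_smul_eq_quadraticTwist W hd
  have hordA : IsOrdinaryAt A 2 := X.twist_ordinary A C hA
  haveI : NeZero (A.conductorNorm ℤ) := ⟨(A.conductorNorm_pos_holds).ne'⟩
  obtain ⟨πA⟩ := hMod A
  obtain ⟨L₀', hL₀'⟩ := exists_iwasawaToPowerSeries_eq_padicLFunction_two_auto hordA πA.isNewformOf
  obtain ⟨hL₀'0, hL₀'1⟩ := lift_ne_zero_and_eq hordA πA.isNewformOf hL₀'
  have hb' : (A.selmerDualData κ hγ).lambda ≤ lam L₀' :=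
    (Summit.BirchSwinnertonDyer.BirchSwinnertonDyer.Theorems.GVISeed.isTorsion_and_lambda_le_lam_of_kato A
      (hKato A πA.f) hκ hγ hγ' hordA πA.isNewformOf (A.selmerDualData κ hγ) one_ne_zero hL₀'1 hL₀'0).2
  -- W2: Greenberg frames at `2` and the divisibility away from `Λ^{cyc}` (pair′)
  obtain ⟨LK, G, Fr, hGW, s, hs0, hsW, hdiv⟩ :=
    stub_xiDominantGreenbergDivisibilityAtTwo W hCM hGO hs κ γ hκ hγ hγ' π X (hKato W π.f) A C hA πA.f
      πA.isNewformOf (hKato A πA.f)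
  -- P1: anticyclotomic `μ₂ = 0` removes the `Λ^{cyc}`-primes: `2`-power-localised Greenberg divisibility
  have h2 := stub_anticycMuZeroAtTwo W hCM hGO hs κ γ hκ hγ hγ' π X LK G Fr hGW _ s hs0 hsW hdiv
  -- BF2: zeta-element conversion to the ordinary side (pair), `⊗ℚ`
  obtain ⟨F, hF, hFc, hordDiv⟩ :=
    stub_zetaConversionAtTwo W hCM hGO hs κ γ hκ hγ hγ' π X LK G Fr hGW (hKato W π.f) A C hA πA.f
      πA.isNewformOf (hKato A πA.f) h2
  -- D: cyclotomic descent to the joint `λ`-inequality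
  have hjoint : lam L₀ + lam L₀' ≤ D.lambda + (A.selmerDualData κ hγ).lambda :=
    stub_cycDescentAtTwo W hCM hGO hs κ γ hκ hγ hγ' hord π X F hF hFc hordDiv (hKato W π.f) A C hA hordA
      πA.f πA.isNewformOf (hKato A πA.f) D (A.selmerDualData κ hγ) 1 1 L₀ L₀' hL₀0 hL₀'0 hL₀1 hL₀'1
  -- `ω`-spine
  refine ⟨1, L₀, hL₀0, hL₀1, ?_⟩
  omega

end Summit.BirchSwinnertonDyer.BirchSwinnertonDyer.Cruxes.OrdLambdaHalfAtTwo.XiDominantKlingenTwo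

end
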